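import Mathlib.Algebra.Module.ZLattice.Basic
import Literature.NumberTheory.Automorphic.CuspFormsRapidDecayUnipotentArch
import Literature.NumberTheory.Automorphic.ReductionTheoryGLnConjugation
import Literature.NumberTheory.Automorphic.GLnMaximalCompactCompact
import Literature.NumberTheory.Automorphic.IdeleClassGroupProofs
import HarnessLib

/-!
# Moeglin–Waldspurger's Lemma I.2.10 for `GL_n`, cuspidal case — the archimedean bricks:
# expansion of iterated derivatives in a basis, lattice periodicity, and the scaling of the
# twisted block directions `Ad(g_∞⁻¹) X` on Siegel sets (MW's assertion (1))
(Moeglin–Waldspurger, *Spectral decomposition and Eisenstein series* (1995), proof of Lemma I.2.10,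
assertion (1): "`|⟨Ad(g_∞⁻¹) X_{iℓ}, X_j^*⟩| ≤ c₁ m_{P₀}(g)^{-α}` for `g ∈ S`")

Topic `NumberTheory/Automorphic`; bricks of the discharge of the named fact
`AutomorphicRepsGL.siegelGrowthBound_rootShift_of_cuspCondition` (MW Lemma I.2.10 for `GL_n` over a
number field, cuspidal case; file `AutomorphicRepsGLCuspFormsRapidDecayMW`). Everything here is
proved:

* `IsArchSmooth.iterLieDeriv_ofFn_eq_sum_coord` — **full expansion of an iterated Lie derivative in
  the real basis `glInfBasis` of `𝔤𝔩_n(K_∞)`**: for `φ` smooth in the archimedean variable and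
  directions `v₀, …, v_{h-1}`,
  `v₀ ⋯ v_{h-1} φ = ∑_{J : Fin h → basis} (∏_q coord_{J q}(v_q)) · b_{J 0} ⋯ b_{J (h-1)} φ`
  (multilinearity, `IsArchSmooth.lieDeriv_eq_sum_coord` iterated); hence the bound
  `norm_iterLieDeriv_ofFn_apply_le`: if all coordinates of the `v_q` are `≤ c` in absolute value
  and all basis words of length `h` applied to `φ` are `≤ B` at `g`, then
  `‖(v₀ ⋯ v_{h-1} φ)(g)‖ ≤ D^h c^h B` (`D = dim_ℝ 𝔤𝔩_n(K_∞)`) — MW: "`|δ(X'^h)φ| ≤ c_h m_{P₀}(g)^{-hα}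
  sup |δ(X_{j_1} ⋯ X_{j_h})φ|`".
* `apply_add_eq_of_mem_span_of_forall_apply_add_basis`, `apply_eq_apply_fract` — **lattice
  periodicity**: a function on a real vector space which is periodic under the vectors of a basis
  `b` is periodic under the `ℤ`-span of `b`, hence takes at `v` its value at the representative
  `ZSpan.fract b v` of `v` in the (bounded) fundamental parallelepiped (MW: the function
  `(x_ℓ) ↦ φ_{i-1}(exp(∑ x_ℓ X_{iℓ}) a g)` "is invariant under `ℤ^d`").
* The archimedean components (`GLn.toMixed`) of the factors of a Siegel-set point
  `z(ρ) · ω · diag(a) · k`: `coe_toMixed_posRealScalar` (a real scalar matrix),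
  `coe_toMixed_posRealDiagonal` (the real diagonal matrix `diag(a)`),
  `blockTriangular_coe_toMixed` (upper triangular for `ω` in the Borel subgroup), and
  `conj_blockMatrixOf_apply_eq_zero` (`W⁻¹ B W` is again a block matrix for `W` upper triangular).
* `twistedBlockDir_siegel_eq_sum` — **the twisted direction on a Siegel set**:
  `Ad((z ω s k)_∞⁻¹) B = ∑_{p,q} (a_q/a_p) · k_∞⁻¹ E_{pq}((ω_∞⁻¹ B ω_∞)_{pq}) k_∞`, the sum over the
  block positions `p < j₀ ≤ q` only (elsewhere the entries vanish); and
  `exists_forall_abs_coord_twistedBlockDir_le` — **MW's assertion (1) for `GL_n`**: for a Siegel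
  datum `(Ω, t₁)`, the simple root `α = e_{i₀} - e_{j₀}` of the maximal parabolic `P_{j₀}` and
  finitely many block directions `B_ι`, there is `C` with
  `|coord_e(Ad(y_∞⁻¹) B_ι)| ≤ (a_{j₀}/a_{i₀}) · C` for every `y = z(ρ) ω diag(a) k` (`ω ∈ Ω`,
  `diag(a) ∈ A_{T₀}(t₁)`, `k ∈ K`) — the block ratios `a_q/a_p` are at most
  `(a_{j₀}/a_{i₀}) max(1,t₁⁻¹)^{2n}` on the cone (`siegelCone_blockRatio_le`) and the remaining factor
  is continuous in `(ω, k)` on the compact `closure Ω × K`.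

## References

* C. Moeglin, J.-L. Waldspurger, *Spectral decomposition and Eisenstein series*, Cambridge Tracts
  in Math. 113 (1995), proof of Lemma I.2.10, assertion (1) [MoeglinWaldspurger1995].
* A. Borel, *Automorphic forms on SL₂(ℝ)* (1997), proof of Lemma 7.4 (the same scaling for
  `SL₂`) [Borel1997].
-/

noncomputable section

open scoped MatrixGroups Matrix Classical NNReal Pointwise
open NumberField NumberField.mixedEmbedding IsDedekindDomain Set
open _root_.Topology

namespace Literature.NumberTheory.Automorphic

/-! ### 1. Full expansion of iterated Lie derivatives in the basis of `𝔤𝔩_n(K_∞)` -/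

section Expansion

variable {n : ℕ} {K : Type} [Field K] [NumberField K]

-- `M_n(K_∞)` is finite-dimensional over `ℝ` (a theorem of `GLnCuspidalSpectrumSiegelProofs`, used as a
-- local instance exactly as in `TestFunctionLieDeriv`)
attribute [local instance] finiteDimensional_matrix_mixedSpace

/-- The index type of the real basis `glInfBasis n K` of `𝔤𝔩_n(K_∞)`. [folklore] -/
abbrev GlInfIndex (n : ℕ) (K : Type) [Field K] [NumberField K] : Type :=
  Fin (Module.finrank ℝ (Matrix (Fin n) (Fin n) (mixedSpace K)))

/-- The iterated Lie derivative along the basis word `b_{J 0} ⋯ b_{J (h-1)}`. [folklore] -/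
abbrev basisWordDeriv {h : ℕ} (J : Fin h → GlInfIndex n K)
    (φ : GL (Fin n) (AdeleRing (𝓞 K) K) → ℂ) : GL (Fin n) (AdeleRing (𝓞 K) K) → ℂ :=
  iterLieDeriv (glArch n K) (List.ofFn fun q => lieOf (glInfBasis n K (J q))) φ

/-- **Full expansion of an iterated Lie derivative in the basis.** For `φ` smooth in the
archimedean variable and directions `v : Fin h → 𝔤𝔩_n(K_∞)`,
`v₀ ⋯ v_{h-1} φ = ∑_{J : Fin h → basis} (∏_q coord_{J q}(v_q)) · b_{J 0} ⋯ b_{J (h-1)} φ`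
(`ℝ`-multilinearity of `(v₀, …, v_{h-1}) ↦ v₀ ⋯ v_{h-1} φ` on smooth functions: expand the first
letter by `IsArchSmooth.lieDeriv_eq_sum_coord` and the rest by induction, using the linearity of
`lieDeriv` in the function on sums of smooth functions). Moeglin–Waldspurger (1995), proof of
Lemma I.2.10 ("`δ(X'^h)` … `sup |δ(X_{j_1} ⋯ X_{j_h}) φ|`"); Borel (1997), proof of Lemma 7.4.
[cite: MoeglinWaldspurger1995, proof of Lemma I.2.10] -/
theorem IsArchSmooth.iterLieDeriv_ofFn_eq_sum_coord {φ : GL (Fin n) (AdeleRing (𝓞 K) K) → ℂ}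
    (hφ : IsArchSmooth (glArch n K) φ) :
    ∀ {h : ℕ} (v : Fin h → (archGroupGL n K).lie),
      iterLieDeriv (glArch n K) (List.ofFn v) φ =
        ∑ J : Fin h → GlInfIndex n K,
          ((∏ q, (glInfBasis n K).coord (J q) (v q : Matrix (Fin n) (Fin n) (mixedSpace K)) : ℝ) : ℂ) •
            basisWordDeriv J φ := by
  intro h
  induction h with
  | zero =>
    intro v
    rw [List.ofFn_zero, iterLieDeriv_nil, Fintype.sum_unique]
    simp only [Finset.univ_eq_empty, Finset.prod_empty, Complex.ofReal_one, one_smul]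
    rfl
  | succ h ih =>
    intro v
    -- smoothness of all basis words applied to `φ`
    have hsm : ∀ J : Fin h → GlInfIndex n K, IsArchSmooth (glArch n K) (basisWordDeriv J φ) :=
      fun J => hφ.iterLieDeriv_gl _
    rw [List.ofFn_succ, iterLieDeriv_cons, ih (fun i => v i.succ),
      IsArchSmooth.lieDeriv_finset_sum_smul (glArch n K) (v 0) Finset.univ _ hsm]
    -- expand the first letter
    have hfirst : ∀ J : Fin h → GlInfIndex n K,
        lieDeriv (glArch n K) (v 0) (basisWordDeriv J φ) =
          ∑ e, ((glInfBasis n K).coord e (v 0 : Matrix (Fin n) (Fin n) (mixedSpace K)) : ℂ) •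
            basisWordDeriv (Fin.cons e J : Fin (h + 1) → GlInfIndex n K) φ := by
      intro J
      rw [(hsm J).lieDeriv_eq_sum_coord (v 0)]
      refine Finset.sum_congr rfl fun e _ => ?_
      rw [real_smul_fun_eq_coe_smul]
      congr 1
      change _ = iterLieDeriv (glArch n K)
        (List.ofFn fun q : Fin (h + 1) => lieOf (glInfBasis n K ((Fin.cons e J : Fin (h + 1) → _) q))) φ
      rw [List.ofFn_succ]
      simp only [Fin.cons_zero, Fin.cons_succ, iterLieDeriv_cons]
    simp_rw [hfirst, Finset.smul_sum, smul_smul]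
    -- reindex the right-hand side along `Fin.cons`
    rw [← (Fin.consEquiv fun _ : Fin (h + 1) => GlInfIndex n K).sum_comp, Fintype.sum_prod_type,
      Finset.sum_comm]
    refine Finset.sum_congr rfl fun e _ => Finset.sum_congr rfl fun J _ => ?_
    have hF : basisWordDeriv ((Fin.consEquiv fun _ : Fin (h + 1) => GlInfIndex n K) (e, J)) φ =
        basisWordDeriv (Fin.cons e J : Fin (h + 1) → GlInfIndex n K) φ := rfl
    rw [hF]
    congr 1
    simp only [Fin.consEquiv_apply, Fin.prod_univ_succ, Fin.cons_zero, Fin.cons_succ,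
      Complex.ofReal_mul]
    ring

/-- **Bound for an iterated Lie derivative through the basis words**: if all coordinates of the
directions `v_q` are at most `c` in absolute value and all basis words of length `h` applied to
`φ` are at most `B` in norm at the point `g`, then `‖(v₀ ⋯ v_{h-1} φ)(g)‖ ≤ D^h · c^h · B`, where
`D = dim_ℝ 𝔤𝔩_n(K_∞)` (there are `D^h` words and each coefficient is a product of `h`
coordinates). Moeglin–Waldspurger (1995), proof of Lemma I.2.10 (the constant `c_h`).
[cite: MoeglinWaldspurger1995, proof of Lemma I.2.10] -/
theorem IsArchSmooth.norm_iterLieDeriv_ofFn_apply_le {φ : GL (Fin n) (AdeleRing (𝓞 K) K) → ℂ}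
    (hφ : IsArchSmooth (glArch n K) φ) {h : ℕ} (v : Fin h → (archGroupGL n K).lie) {c : ℝ}
    (hc : 0 ≤ c)
    (hv : ∀ q e, |(glInfBasis n K).coord e (v q : Matrix (Fin n) (Fin n) (mixedSpace K))| ≤ c)
    (g : GL (Fin n) (AdeleRing (𝓞 K) K)) {B : ℝ}
    (hB : ∀ J : Fin h → GlInfIndex n K, ‖basisWordDeriv J φ g‖ ≤ B) :
    ‖iterLieDeriv (glArch n K) (List.ofFn v) φ g‖ ≤
      (Module.finrank ℝ (Matrix (Fin n) (Fin n) (mixedSpace K)) : ℝ) ^ h * c ^ h * B := by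
  rw [hφ.iterLieDeriv_ofFn_eq_sum_coord v, Finset.sum_apply]
  refine (norm_sum_le _ _).trans ?_
  have hterm : ∀ J : Fin h → GlInfIndex n K,
      ‖(((∏ q, (glInfBasis n K).coord (J q) (v q : Matrix (Fin n) (Fin n) (mixedSpace K)) : ℝ) : ℂ) •
        basisWordDeriv J φ) g‖ ≤ c ^ h * B := by
    intro J
    rw [Pi.smul_apply, _root_.norm_smul, Complex.norm_real, Real.norm_eq_abs, Finset.abs_prod]
    refine mul_le_mul ?_ (hB J) (norm_nonneg _) (pow_nonneg hc _)
    calc ∏ q, |(glInfBasis n K).coord (J q) (v q : Matrix (Fin n) (Fin n) (mixedSpace K))|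
        ≤ ∏ _q : Fin h, c := Finset.prod_le_prod (fun q _ => abs_nonneg _) fun q _ => hv q (J q)
      _ = c ^ h := by rw [Finset.prod_const, Finset.card_univ, Fintype.card_fin]
  calc ∑ J : Fin h → GlInfIndex n K,
        ‖(((∏ q, (glInfBasis n K).coord (J q) (v q : Matrix (Fin n) (Fin n) (mixedSpace K)) : ℝ) : ℂ) •
          basisWordDeriv J φ) g‖
      ≤ ∑ _J : Fin h → GlInfIndex n K, c ^ h * B := Finset.sum_le_sum fun J _ => hterm J
    _ = (Module.finrank ℝ (Matrix (Fin n) (Fin n) (mixedSpace K)) : ℝ) ^ h * c ^ h * B := by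
        rw [Finset.sum_const, Finset.card_univ, Fintype.card_fun, Fintype.card_fin, Fintype.card_fin,
          nsmul_eq_mul]
        push_cast
        ring

end Expansion

/-! ### 2. Lattice periodicity on a real vector space -/

section Lattice

variable {E : Type*} [NormedAddCommGroup E] [NormedSpace ℝ E] {ι : Type*} [Fintype ι]
  {α : Type*}

omit [Fintype ι] in
/-- **A function periodic under the vectors of a basis is periodic under their `ℤ`-span**
(induction over the span: sums, negatives and integer multiples of periods are periods).
[folklore] -/
theorem apply_add_eq_of_mem_span_of_forall_apply_add_basis (b : Module.Basis ι ℝ E) {G : E → α}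
    (hper : ∀ i v, G (v + b i) = G v) {l : E}
    (hl : l ∈ Submodule.span ℤ (Set.range b)) (v : E) : G (v + l) = G v := by
  induction hl using Submodule.span_induction generalizing v with
  | mem x hx =>
    obtain ⟨i, rfl⟩ := hx
    exact hper i v
  | zero => rw [add_zero]
  | add x y _ _ hx hy => rw [← add_assoc, hy, hx]
  | smul a x _ hx =>
    -- negatives of periods are periods
    have hneg : ∀ w, G (w + -x) = G w := fun w => by
      have h := hx (w + -x)
      rw [neg_add_cancel_right] at h
      exact h.symm
    induction a using Int.induction_on generalizing v with
    | zero => rw [zero_smul, add_zero]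
    | succ i ih => rw [add_smul, one_smul, ← add_assoc, hx, ih]
    | pred i ih => rw [sub_smul, one_smul, sub_eq_add_neg, ← add_assoc, hneg, ih]

/-- **Reduction to the fundamental parallelepiped**: a function periodic under the vectors of a
basis `b` takes at `v` its value at `ZSpan.fract b v ∈ ZSpan.fundamentalDomain b`
(`v = fract v + floor v` with `floor v` in the `ℤ`-span). [folklore] -/
theorem apply_eq_apply_fract (b : Module.Basis ι ℝ E) {G : E → α}
    (hper : ∀ i v, G (v + b i) = G v) (v : E) : G v = G (ZSpan.fract b v) := by
  have h := apply_add_eq_of_mem_span_of_forall_apply_add_basis b hper (ZSpan.floor b v).2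
    (ZSpan.fract b v)
  rw [ZSpan.fract_apply, sub_add_cancel] at h
  rw [← ZSpan.fract_apply] at h
  exact h

/-- The fundamental parallelepiped of a basis of a finite-dimensional real normed space is
relatively compact (it is bounded, `ZSpan.fundamentalDomain_isBounded`). [folklore] -/
theorem isCompact_closure_fundamentalDomain [FiniteDimensional ℝ E] (b : Module.Basis ι ℝ E) :
    IsCompact (closure (ZSpan.fundamentalDomain b)) := by
  haveI : ProperSpace E := FiniteDimensional.proper ℝ E
  exact (ZSpan.fundamentalDomain_isBounded b).isCompact_closure

end Lattice


/-! ### 3. Archimedean components of the factors of a Siegel-set point -/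

section ArchComponents

variable {n : ℕ} {K : Type} [Field K] [NumberField K]

/-- Entries of the archimedean component `g_∞ = GLn.toMixed g`: the archimedean components of the
entries of `g`, read in `mixedSpace K` (definitional). [folklore] -/
theorem GLn.coe_toMixed_apply (g : GL (Fin n) (AdeleRing (𝓞 K) K)) (i j : Fin n) :
    ((GLn.toMixed n K g : GL (Fin n) (mixedSpace K)) : Matrix (Fin n) (Fin n) (mixedSpace K)) i j =
      InfiniteAdeleRing.ringEquiv_mixedSpace K
        (((g : Matrix (Fin n) (Fin n) (AdeleRing (𝓞 K) K)) i j).1) :=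
  rfl

/-- **The archimedean component of `z(ρ) ∈ A_G` is the real scalar matrix `ρ`.** [folklore] -/
theorem GLn.coe_toMixed_posRealScalar (ρ : ℝ≥0ˣ) :
    ((GLn.toMixed n K (posRealScalar n K ρ) : GL (Fin n) (mixedSpace K)) :
        Matrix (Fin n) (Fin n) (mixedSpace K)) =
      Matrix.scalar (Fin n) (algebraMap ℝ (mixedSpace K) ((ρ : ℝ≥0) : ℝ)) := by
  refine Matrix.ext fun i j => ?_
  rw [GLn.coe_toMixed_apply, Matrix.scalar_apply, Matrix.diagonal_apply]
  change InfiniteAdeleRing.ringEquiv_mixedSpace K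
    ((Matrix.scalar (Fin n) ((posRealIdele K ρ : (AdeleRing (𝓞 K) K)ˣ) : AdeleRing (𝓞 K) K) i j).1) = _
  rw [Matrix.scalar_apply, Matrix.diagonal_apply]
  split_ifs with h
  · rw [posRealIdele_fst, ringEquiv_mixedSpace_realToInfiniteAdele]
  · exact map_zero _

/-- **The archimedean component of `diag(a) ∈ A_{T₀}` is the real diagonal matrix `diag(a)`.**
[folklore] -/
theorem GLn.coe_toMixed_posRealDiagonal (a : Fin n → ℝ≥0ˣ) :
    ((GLn.toMixed n K (posRealDiagonal n K a) : GL (Fin n) (mixedSpace K)) :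
        Matrix (Fin n) (Fin n) (mixedSpace K)) =
      Matrix.diagonal fun i => algebraMap ℝ (mixedSpace K) ((a i : ℝ≥0) : ℝ) := by
  refine Matrix.ext fun i j => ?_
  rw [GLn.coe_toMixed_apply, coe_posRealDiagonal, Matrix.diagonal_apply, Matrix.diagonal_apply]
  split_ifs with h
  · rw [posRealIdele_fst, ringEquiv_mixedSpace_realToInfiniteAdele]
  · exact map_zero _

/-- **The archimedean component of an element of the Borel subgroup is upper triangular.**
[folklore] -/
theorem GLn.blockTriangular_coe_toMixed {ω : GL (Fin n) (AdeleRing (𝓞 K) K)}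
    (hω : ω ∈ standardParabolicGL (AdeleRing (𝓞 K) K) (id : Fin n → Fin n)) :
    ((GLn.toMixed n K ω : GL (Fin n) (mixedSpace K)) :
      Matrix (Fin n) (Fin n) (mixedSpace K)).BlockTriangular id := by
  intro i j hij
  have hω' : (ω : Matrix (Fin n) (Fin n) (AdeleRing (𝓞 K) K)).BlockTriangular id := hω
  have h0 : (ω : Matrix (Fin n) (Fin n) (AdeleRing (𝓞 K) K)) i j = 0 := hω' hij
  rw [GLn.coe_toMixed_apply, h0]
  exact map_zero _

/-- **Conjugating a block matrix by upper triangular matrices keeps it in the block**: if `W` and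
`W'` are upper triangular and `B` vanishes outside the block `p < k ≤ q`, then so does `W' B W`
(a non-zero term `W'_{ip} B_{pq} W_{qj}` needs `i ≤ p < k ≤ q ≤ j`). This is "`Ad(p_∞⁻¹)` preserves
`Lie(U(𝔸_∞))`" in Moeglin–Waldspurger's proof of assertion (1). [cite: MoeglinWaldspurger1995, proof of Lemma I.2.10] -/
theorem conj_apply_eq_zero_of_blockTriangular {k : ℕ} {R : Type*} [CommRing R]
    {W W' B : Matrix (Fin n) (Fin n) R} (hW : W.BlockTriangular id) (hW' : W'.BlockTriangular id)
    (hB : ∀ p q : Fin n, ¬((p : ℕ) < k ∧ k ≤ (q : ℕ)) → B p q = 0) {i j : Fin n}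
    (hij : ¬((i : ℕ) < k ∧ k ≤ (j : ℕ))) : (W' * B * W) i j = 0 := by
  rw [Matrix.mul_apply]
  refine Finset.sum_eq_zero fun q _ => ?_
  rw [Matrix.mul_apply, Finset.sum_mul]
  refine Finset.sum_eq_zero fun p _ => ?_
  by_cases hip : i ≤ p
  · by_cases hqj : q ≤ j
    · have hpq : ¬((p : ℕ) < k ∧ k ≤ (q : ℕ)) := fun h =>
        hij ⟨lt_of_le_of_lt (Fin.le_def.1 hip) h.1, h.2.trans (Fin.le_def.1 hqj)⟩
      rw [hB p q hpq, mul_zero, zero_mul]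
    · rw [hW (show id j < id q from not_le.1 hqj), mul_zero]
  · rw [hW' (show id p < id i from not_le.1 hip), zero_mul, zero_mul]

end ArchComponents

/-! ### 4. The twisted block direction on a Siegel set (MW's assertion (1)) -/

section Twisted

variable {n : ℕ} {K : Type} [Field K] [NumberField K]

attribute [local instance] finiteDimensional_matrix_mixedSpace

/-- **Central elements do not twist**: `Ad((z g)_∞⁻¹) B = Ad(g_∞⁻¹) B` for `z = z(ρ) ∈ A_G` (its
archimedean component is a scalar matrix). [folklore] -/
theorem twistedBlockDir_posRealScalar_mul {k : ℕ} (ρ : ℝ≥0ˣ) (g : GL (Fin n) (AdeleRing (𝓞 K) K))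
    (B : ArchBlockSpace n k K) :
    twistedBlockDir n k K (posRealScalar n K ρ * g) B = twistedBlockDir n k K g B := by
  unfold twistedBlockDir
  rw [map_mul, mul_inv_rev, Units.val_mul, Units.val_mul]
  set Z : GL (Fin n) (mixedSpace K) := GLn.toMixed n K (posRealScalar n K ρ) with hZ
  set G : GL (Fin n) (mixedSpace K) := GLn.toMixed n K g with hG
  have hZc : (Z : Matrix (Fin n) (Fin n) (mixedSpace K)) * blockMatrixOf n k K B =
      blockMatrixOf n k K B * (Z : Matrix (Fin n) (Fin n) (mixedSpace K)) := by
    rw [hZ, GLn.coe_toMixed_posRealScalar]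
    exact Matrix.scalar_comm _ (fun r' => Commute.all _ r') _
  calc ((G⁻¹ : GL (Fin n) (mixedSpace K)) : Matrix (Fin n) (Fin n) (mixedSpace K)) *
        ((Z⁻¹ : GL (Fin n) (mixedSpace K)) : Matrix (Fin n) (Fin n) (mixedSpace K)) *
        blockMatrixOf n k K B *
        ((Z : Matrix (Fin n) (Fin n) (mixedSpace K)) * (G : Matrix (Fin n) (Fin n) (mixedSpace K)))
      = ((G⁻¹ : GL (Fin n) (mixedSpace K)) : Matrix (Fin n) (Fin n) (mixedSpace K)) *
          (((Z⁻¹ : GL (Fin n) (mixedSpace K)) : Matrix (Fin n) (Fin n) (mixedSpace K)) *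
            ((Z : Matrix (Fin n) (Fin n) (mixedSpace K)) * blockMatrixOf n k K B)) *
          (G : Matrix (Fin n) (Fin n) (mixedSpace K)) := by
        rw [hZc]; simp only [Matrix.mul_assoc]
    _ = ((G⁻¹ : GL (Fin n) (mixedSpace K)) : Matrix (Fin n) (Fin n) (mixedSpace K)) *
          blockMatrixOf n k K B * (G : Matrix (Fin n) (Fin n) (mixedSpace K)) := by
        rw [← Matrix.mul_assoc ((Z⁻¹ : GL (Fin n) (mixedSpace K)) : Matrix (Fin n) (Fin n) (mixedSpace K)),
          Units.inv_mul, Matrix.one_mul]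

variable (n K) in
/-- The block matrix of the direction `B` conjugated by the archimedean component of `ω`:
`M(ω, B) = ω_∞⁻¹ · blockMatrixOf B · ω_∞` (MW's `Ad(p_∞⁻¹) X_{iℓ}`). [cite: MoeglinWaldspurger1995, proof of Lemma I.2.10] -/
def conjBlockMatrix {k : ℕ} (ω : GL (Fin n) (AdeleRing (𝓞 K) K)) (B : ArchBlockSpace n k K) :
    Matrix (Fin n) (Fin n) (mixedSpace K) :=
  (((GLn.toMixed n K ω)⁻¹ : GL (Fin n) (mixedSpace K)) : Matrix (Fin n) (Fin n) (mixedSpace K)) *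
    blockMatrixOf n k K B * (GLn.toMixed n K ω : Matrix (Fin n) (Fin n) (mixedSpace K))

/-- `M(ω, B)` vanishes outside the block when `ω` lies in the Borel subgroup. [folklore] -/
theorem conjBlockMatrix_apply_eq_zero {k : ℕ} {ω : GL (Fin n) (AdeleRing (𝓞 K) K)}
    (hω : ω ∈ standardParabolicGL (AdeleRing (𝓞 K) K) (id : Fin n → Fin n)) (B : ArchBlockSpace n k K)
    {i j : Fin n} (hij : ¬((i : ℕ) < k ∧ k ≤ (j : ℕ))) : conjBlockMatrix n K ω B i j = 0 := by
  unfold conjBlockMatrix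
  refine conj_apply_eq_zero_of_blockTriangular (GLn.blockTriangular_coe_toMixed hω) ?_
    (fun p q hpq => blockMatrixOf_apply_of_not B hpq) hij
  rw [← map_inv]
  exact GLn.blockTriangular_coe_toMixed (Subgroup.inv_mem _ hω)

variable (n K) in
/-- The elementary twisted directions `T_{pq}(ω, κ, B) = κ_∞⁻¹ · E_{pq}(M(ω, B)_{pq}) · κ_∞`, which
depend continuously on `(ω, κ)` and carry no dependence on the torus variable. [folklore] -/
def elemTwistedDir {k : ℕ} (ω κ : GL (Fin n) (AdeleRing (𝓞 K) K)) (B : ArchBlockSpace n k K)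
    (p q : Fin n) : Matrix (Fin n) (Fin n) (mixedSpace K) :=
  (((GLn.toMixed n K κ)⁻¹ : GL (Fin n) (mixedSpace K)) : Matrix (Fin n) (Fin n) (mixedSpace K)) *
    Matrix.single p q (conjBlockMatrix n K ω B p q) *
      (GLn.toMixed n K κ : Matrix (Fin n) (Fin n) (mixedSpace K))

/-- **The twisted direction at a Siegel-set point** `y = z(ρ) · ω · diag(a) · κ`:
`Ad(y_∞⁻¹) B = ∑_{p,q} (a_q/a_p) · T_{pq}(ω, κ, B)` — the centre drops out, conjugation by
`diag(a)⁻¹` multiplies the `(p,q)` entry of `M(ω, B) = ω_∞⁻¹ B ω_∞` by `a_q/a_p`, and conjugation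
by `κ_∞` is linear (Moeglin–Waldspurger (1995), proof of assertion (1) of Lemma I.2.10: "`Ad(a⁻¹)
X_{i'ℓ'} = ∑ a^{-α} c … X_{i''ℓ''}`"). [cite: MoeglinWaldspurger1995, proof of Lemma I.2.10] -/
theorem twistedBlockDir_siegel_eq_sum {k : ℕ} (ρ : ℝ≥0ˣ) (ω : GL (Fin n) (AdeleRing (𝓞 K) K))
    (a : Fin n → ℝ≥0ˣ) (κ : GL (Fin n) (AdeleRing (𝓞 K) K)) (B : ArchBlockSpace n k K) :
    twistedBlockDir n k K (posRealScalar n K ρ * (ω * posRealDiagonal n K a * κ)) B =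
      ∑ p, ∑ q, (((a q : ℝ≥0) : ℝ) / ((a p : ℝ≥0) : ℝ)) • elemTwistedDir n K ω κ B p q := by
  rw [twistedBlockDir_posRealScalar_mul]
  unfold twistedBlockDir elemTwistedDir
  set W : GL (Fin n) (mixedSpace K) := GLn.toMixed n K ω with hW
  set S : GL (Fin n) (mixedSpace K) := GLn.toMixed n K (posRealDiagonal n K a) with hS
  set Kk : GL (Fin n) (mixedSpace K) := GLn.toMixed n K κ with hKk
  set M : Matrix (Fin n) (Fin n) (mixedSpace K) := conjBlockMatrix n K ω B with hM
  -- the matrices of `S` and `S⁻¹`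
  have hSv : (S : Matrix (Fin n) (Fin n) (mixedSpace K)) =
      Matrix.diagonal fun i => algebraMap ℝ (mixedSpace K) ((a i : ℝ≥0) : ℝ) := by
    rw [hS]; exact GLn.coe_toMixed_posRealDiagonal a
  have hSi : ((S⁻¹ : GL (Fin n) (mixedSpace K)) : Matrix (Fin n) (Fin n) (mixedSpace K)) =
      Matrix.diagonal fun i => algebraMap ℝ (mixedSpace K) (((a i : ℝ≥0) : ℝ))⁻¹ := by
    rw [hS, ← map_inv, ← map_inv, GLn.coe_toMixed_posRealDiagonal]
    refine congrArg Matrix.diagonal (funext fun i => ?_)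
    rw [Pi.inv_apply, Units.val_inv_eq_inv_val, NNReal.coe_inv]
  -- `S⁻¹ M S = ∑ (a_q/a_p) • E_{pq}(M_{pq})`
  have hSMS : ((S⁻¹ : GL (Fin n) (mixedSpace K)) : Matrix (Fin n) (Fin n) (mixedSpace K)) * M *
      (S : Matrix (Fin n) (Fin n) (mixedSpace K)) =
        ∑ p, ∑ q, (((a q : ℝ≥0) : ℝ) / ((a p : ℝ≥0) : ℝ)) • Matrix.single p q (M p q) := by
    have hentry : ∀ p q, (((S⁻¹ : GL (Fin n) (mixedSpace K)) : Matrix (Fin n) (Fin n) (mixedSpace K)) * M *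
        (S : Matrix (Fin n) (Fin n) (mixedSpace K))) p q =
          (((a q : ℝ≥0) : ℝ) / ((a p : ℝ≥0) : ℝ)) • M p q := by
      intro p q
      rw [hSv, hSi, Matrix.mul_diagonal, Matrix.diagonal_mul, ← Algebra.smul_def, ← Algebra.commutes,
        ← Algebra.smul_def, smul_smul, div_eq_mul_inv]
    conv_lhs => rw [Matrix.matrix_eq_sum_single
      (((S⁻¹ : GL (Fin n) (mixedSpace K)) : Matrix (Fin n) (Fin n) (mixedSpace K)) * M *
        (S : Matrix (Fin n) (Fin n) (mixedSpace K)))]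
    refine Finset.sum_congr rfl fun p _ => Finset.sum_congr rfl fun q _ => ?_
    rw [hentry, Matrix.smul_single]
  -- assemble
  rw [map_mul, map_mul, mul_inv_rev, mul_inv_rev, Units.val_mul, Units.val_mul, Units.val_mul,
    Units.val_mul]
  change ((Kk⁻¹ : GL (Fin n) (mixedSpace K)) : Matrix (Fin n) (Fin n) (mixedSpace K)) *
      (((S⁻¹ : GL (Fin n) (mixedSpace K)) : Matrix (Fin n) (Fin n) (mixedSpace K)) *
        ((W⁻¹ : GL (Fin n) (mixedSpace K)) : Matrix (Fin n) (Fin n) (mixedSpace K))) *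
      blockMatrixOf n k K B *
      ((W : Matrix (Fin n) (Fin n) (mixedSpace K)) * (S : Matrix (Fin n) (Fin n) (mixedSpace K)) *
        (Kk : Matrix (Fin n) (Fin n) (mixedSpace K))) = _
  have hassoc : ((Kk⁻¹ : GL (Fin n) (mixedSpace K)) : Matrix (Fin n) (Fin n) (mixedSpace K)) *
      (((S⁻¹ : GL (Fin n) (mixedSpace K)) : Matrix (Fin n) (Fin n) (mixedSpace K)) *
        ((W⁻¹ : GL (Fin n) (mixedSpace K)) : Matrix (Fin n) (Fin n) (mixedSpace K))) *
      blockMatrixOf n k K B *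
      ((W : Matrix (Fin n) (Fin n) (mixedSpace K)) * (S : Matrix (Fin n) (Fin n) (mixedSpace K)) *
        (Kk : Matrix (Fin n) (Fin n) (mixedSpace K))) =
      ((Kk⁻¹ : GL (Fin n) (mixedSpace K)) : Matrix (Fin n) (Fin n) (mixedSpace K)) *
        ((((S⁻¹ : GL (Fin n) (mixedSpace K)) : Matrix (Fin n) (Fin n) (mixedSpace K)) * M *
          (S : Matrix (Fin n) (Fin n) (mixedSpace K)))) *
        (Kk : Matrix (Fin n) (Fin n) (mixedSpace K)) := by
    rw [hM]; unfold conjBlockMatrix; rw [← hW]; simp only [Matrix.mul_assoc]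
  rw [hassoc, hSMS, Finset.mul_sum, Finset.sum_mul]
  refine Finset.sum_congr rfl fun p _ => ?_
  rw [Finset.mul_sum, Finset.sum_mul]
  refine Finset.sum_congr rfl fun q _ => ?_
  rw [Matrix.mul_smul, Matrix.smul_mul]

/-- The elementary twisted directions vanish off the block (for `ω` in the Borel subgroup).
[folklore] -/
theorem elemTwistedDir_eq_zero {k : ℕ} {ω : GL (Fin n) (AdeleRing (𝓞 K) K)}
    (hω : ω ∈ standardParabolicGL (AdeleRing (𝓞 K) K) (id : Fin n → Fin n))
    (κ : GL (Fin n) (AdeleRing (𝓞 K) K)) (B : ArchBlockSpace n k K) {p q : Fin n}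
    (hpq : ¬((p : ℕ) < k ∧ k ≤ (q : ℕ))) : elemTwistedDir n K ω κ B p q = 0 := by
  unfold elemTwistedDir
  rw [conjBlockMatrix_apply_eq_zero hω B hpq, Matrix.single_zero, Matrix.mul_zero, Matrix.zero_mul]

/-- `x ↦ E_{pq}(x)` is continuous. [folklore] -/
theorem continuous_matrix_single {R : Type*} [Zero R] [TopologicalSpace R] (p q : Fin n) :
    Continuous fun x : R => Matrix.single p q x := by
  refine continuous_matrix fun i j => ?_
  by_cases h : p = i ∧ q = j
  · simp only [Matrix.single, Matrix.of_apply, if_pos h]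
    exact continuous_id
  · simp only [Matrix.single, Matrix.of_apply, if_neg h]
    exact continuous_const

/-- The elementary twisted directions depend continuously on `(ω, κ)`. [folklore] -/
theorem continuous_elemTwistedDir {k : ℕ} (B : ArchBlockSpace n k K) (p q : Fin n) :
    Continuous fun ωκ : GL (Fin n) (AdeleRing (𝓞 K) K) × GL (Fin n) (AdeleRing (𝓞 K) K) =>
      elemTwistedDir n K ωκ.1 ωκ.2 B p q := by
  have hval : ∀ {f : GL (Fin n) (AdeleRing (𝓞 K) K) × GL (Fin n) (AdeleRing (𝓞 K) K) →
      GL (Fin n) (mixedSpace K)}, Continuous f →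
      Continuous fun x => ((f x : GL (Fin n) (mixedSpace K)) : Matrix (Fin n) (Fin n) (mixedSpace K)) :=
    fun hf => Units.continuous_val.comp hf
  have h1 : Continuous fun ωκ : GL (Fin n) (AdeleRing (𝓞 K) K) × GL (Fin n) (AdeleRing (𝓞 K) K) =>
      GLn.toMixed n K ωκ.1 := (GLn.continuous_toMixed n K).comp continuous_fst
  have h2 : Continuous fun ωκ : GL (Fin n) (AdeleRing (𝓞 K) K) × GL (Fin n) (AdeleRing (𝓞 K) K) =>
      GLn.toMixed n K ωκ.2 := (GLn.continuous_toMixed n K).comp continuous_snd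
  have hM : Continuous fun ωκ : GL (Fin n) (AdeleRing (𝓞 K) K) × GL (Fin n) (AdeleRing (𝓞 K) K) =>
      conjBlockMatrix n K ωκ.1 B := by
    unfold conjBlockMatrix
    exact ((hval h1.inv).mul continuous_const).mul (hval h1)
  unfold elemTwistedDir
  exact ((hval h2.inv).mul ((continuous_matrix_single p q).comp (hM.matrix_elem p q))).mul (hval h2)

/-- **Moeglin–Waldspurger's assertion (1) for `GL_n`.** Fix a Siegel datum (`Ω ⊆ N(𝔸) M(𝔸)¹`
relatively compact, `t₁ > 0`), the simple root `α = e_{i₀} - e_{j₀}` (`j₀ = i₀ + 1`) of the maximal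
parabolic `P_{j₀}`, and finitely many archimedean block directions `B_ι`. Then there is `C ≥ 0`
such that for every Siegel-set point `y = z(ρ) ω diag(a) κ` (`ω ∈ Ω`, `t₁ a_{l+1} ≤ a_l`,
`κ ∈ K`) every coordinate of every twisted direction `Ad(y_∞⁻¹) B_ι` in the basis `glInfBasis` is
at most `(a_{j₀}/a_{i₀}) · C` in absolute value: by `twistedBlockDir_siegel_eq_sum` the coordinate is
`∑_{p<j₀≤q} (a_q/a_p) coord(T_{pq}(ω, κ, B_ι))`, the block ratios satisfy
`a_q/a_p ≤ (a_{j₀}/a_{i₀}) max(1,t₁⁻¹)^{2n}` on the cone (`siegelCone_blockRatio_le`), and the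
coordinates of the `T_{pq}` are bounded on the compact `closure Ω × K` by continuity.
(Printed: "there exists `c₁ > 0` such that … `|⟨Ad(g_∞⁻¹)X_{iℓ}, X_j^*⟩| ≤ c₁ m_{P₀}(g)^{-α}`".)
[cite: MoeglinWaldspurger1995, Lemma I.2.10, assertion (1)] -/
theorem exists_forall_abs_coord_twistedBlockDir_le {i₀ j₀ : Fin n} (hij : (j₀ : ℕ) = (i₀ : ℕ) + 1)
    {Ω : Set (GL (Fin n) (AdeleRing (𝓞 K) K))}
    (hΩ : Ω ⊆ (upperUnitriangular (Fin n) (AdeleRing (𝓞 K) K) : Set (GL (Fin n) (AdeleRing (𝓞 K) K))) *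
      (normOneDiagonal n K : Set (GL (Fin n) (AdeleRing (𝓞 K) K))))
    (hΩc : IsCompact (closure Ω)) {t₁ : ℝ} (ht₁ : 0 < t₁) {ιB : Type*} [Fintype ιB]
    (B : ιB → ArchBlockSpace n j₀ K) :
    ∃ C : ℝ, 0 ≤ C ∧ ∀ (ρ : ℝ≥0ˣ), ∀ ω ∈ Ω, ∀ a : Fin n → ℝ≥0ˣ,
      (∀ i j : Fin n, (j : ℕ) = (i : ℕ) + 1 → t₁ * ((a j : ℝ≥0) : ℝ) ≤ ((a i : ℝ≥0) : ℝ)) →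
      ∀ κ ∈ standardMaximalCompactGL n K, ∀ (ι : ιB) (e : GlInfIndex n K),
        |(glInfBasis n K).coord e
            (twistedBlockDir n j₀ K (posRealScalar n K ρ * (ω * posRealDiagonal n K a * κ)) (B ι))| ≤
          ((a j₀ : ℝ≥0) : ℝ) / ((a i₀ : ℝ≥0) : ℝ) * C := by
  -- the continuous majorant on `closure Ω × K`
  set F : GL (Fin n) (AdeleRing (𝓞 K) K) × GL (Fin n) (AdeleRing (𝓞 K) K) → ℝ := fun ωκ =>
    ∑ ι, ∑ e : GlInfIndex n K, ∑ p, ∑ q,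
      |(glInfBasis n K).coord e (elemTwistedDir n K ωκ.1 ωκ.2 (B ι) p q)| with hF
  have hcoord : ∀ e : GlInfIndex n K, Continuous fun X : Matrix (Fin n) (Fin n) (mixedSpace K) =>
      (glInfBasis n K).coord e X := fun e =>
    ((glInfBasis n K).coord e).continuous_of_finiteDimensional
  have hFc : Continuous F := by
    refine continuous_finsetSum _ fun ι _ => continuous_finsetSum _ fun e _ =>
      continuous_finsetSum _ fun p _ => continuous_finsetSum _ fun q _ => ?_
    exact continuous_abs.comp ((hcoord e).comp (continuous_elemTwistedDir (B ι) p q))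
  have hΘ : IsCompact (closure Ω ×ˢ (standardMaximalCompactGL n K : Set (GL (Fin n) (AdeleRing (𝓞 K) K)))) :=
    hΩc.prod (isCompact_standardMaximalCompactGL n K)
  obtain ⟨Cf, hCf⟩ := hΘ.exists_bound_of_continuousOn hFc.continuousOn
  set R : ℝ := max 1 t₁⁻¹ ^ n * max 1 t₁⁻¹ ^ n with hR
  have hR0 : 0 ≤ R := by positivity
  have hCf0 : 0 ≤ max Cf 0 := le_max_right _ _
  refine ⟨R * ((n : ℝ) * (n : ℝ)) * max Cf 0, by positivity, fun ρ ω hω a hroot κ hκ ι e => ?_⟩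
  -- `ω` lies in the Borel subgroup
  have hωB : ω ∈ standardParabolicGL (AdeleRing (𝓞 K) K) (id : Fin n → Fin n) :=
    upperUnitriangular_mul_normOneDiagonal_subset (hΩ hω)
  have ha0 : ∀ i, 0 < ((a i : ℝ≥0) : ℝ) := fun i =>
    NNReal.coe_pos.2 (pos_iff_ne_zero.2 (a i).ne_zero)
  set r : ℝ := ((a j₀ : ℝ≥0) : ℝ) / ((a i₀ : ℝ≥0) : ℝ) with hr
  have hr0 : 0 ≤ r := (div_pos (ha0 j₀) (ha0 i₀)).le
  -- the value of `F` at `(ω, κ)` bounds each elementary coordinate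
  have hFωκ : F (ω, κ) ≤ max Cf 0 := by
    have h := hCf (ω, κ) (mk_mem_prod (subset_closure hω) hκ)
    rw [Real.norm_eq_abs] at h
    exact ((le_abs_self _).trans h).trans (le_max_left _ _)
  have helem : ∀ p q, |(glInfBasis n K).coord e (elemTwistedDir n K ω κ (B ι) p q)| ≤ max Cf 0 := by
    intro p q
    refine le_trans ?_ hFωκ
    rw [hF]
    refine (Finset.single_le_sum (f := fun ι' => ∑ e : GlInfIndex n K, ∑ p, ∑ q,
      |(glInfBasis n K).coord e (elemTwistedDir n K ω κ (B ι') p q)|)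
      (fun ι' _ => by positivity) (Finset.mem_univ ι)).trans' ?_
    refine (Finset.single_le_sum (f := fun e' : GlInfIndex n K => ∑ p, ∑ q,
      |(glInfBasis n K).coord e' (elemTwistedDir n K ω κ (B ι) p q)|)
      (fun e' _ => by positivity) (Finset.mem_univ e)).trans' ?_
    refine (Finset.single_le_sum (f := fun p' => ∑ q,
      |(glInfBasis n K).coord e (elemTwistedDir n K ω κ (B ι) p' q)|)
      (fun p' _ => by positivity) (Finset.mem_univ p)).trans' ?_
    exact Finset.single_le_sum (f := fun q' =>
      |(glInfBasis n K).coord e (elemTwistedDir n K ω κ (B ι) p q')|)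
      (fun q' _ => abs_nonneg _) (Finset.mem_univ q)
  -- each term of the double sum is at most `r * R * (its elementary coordinate)`
  have hterm : ∀ p q, |(((a q : ℝ≥0) : ℝ) / ((a p : ℝ≥0) : ℝ)) *
      (glInfBasis n K).coord e (elemTwistedDir n K ω κ (B ι) p q)| ≤
        r * R * |(glInfBasis n K).coord e (elemTwistedDir n K ω κ (B ι) p q)| := by
    intro p q
    by_cases hpq : (p : ℕ) < (j₀ : ℕ) ∧ (j₀ : ℕ) ≤ (q : ℕ)
    · rw [abs_mul, abs_of_nonneg (div_pos (ha0 q) (ha0 p)).le]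
      refine mul_le_mul_of_nonneg_right ?_ (abs_nonneg _)
      have h := siegelCone_blockRatio_le (k := (j₀ : ℕ)) ht₁ hroot (κ := j₀) (κ' := i₀) rfl hij.symm
        hpq.1 hpq.2
      rw [hr, hR, ← mul_assoc]
      exact h
    · simp [elemTwistedDir_eq_zero hωB κ (B ι) hpq]
  -- sum up
  rw [twistedBlockDir_siegel_eq_sum, map_sum]
  simp_rw [map_sum, map_smul, smul_eq_mul]
  calc |∑ p, ∑ q, ((a q : ℝ≥0) : ℝ) / ((a p : ℝ≥0) : ℝ) *
          (glInfBasis n K).coord e (elemTwistedDir n K ω κ (B ι) p q)|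
      ≤ ∑ p, |∑ q, ((a q : ℝ≥0) : ℝ) / ((a p : ℝ≥0) : ℝ) *
          (glInfBasis n K).coord e (elemTwistedDir n K ω κ (B ι) p q)| := Finset.abs_sum_le_sum_abs _ _
    _ ≤ ∑ p, ∑ q, |((a q : ℝ≥0) : ℝ) / ((a p : ℝ≥0) : ℝ) *
          (glInfBasis n K).coord e (elemTwistedDir n K ω κ (B ι) p q)| :=
        Finset.sum_le_sum fun p _ => Finset.abs_sum_le_sum_abs _ _
    _ ≤ ∑ p, ∑ q, r * R * |(glInfBasis n K).coord e (elemTwistedDir n K ω κ (B ι) p q)| :=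
        Finset.sum_le_sum fun p _ => Finset.sum_le_sum fun q _ => hterm p q
    _ = r * R * ∑ p, ∑ q, |(glInfBasis n K).coord e (elemTwistedDir n K ω κ (B ι) p q)| := by
        rw [Finset.mul_sum]
        refine Finset.sum_congr rfl fun p _ => ?_
        rw [Finset.mul_sum]
    _ ≤ r * R * ∑ _p : Fin n, ∑ _q : Fin n, max Cf 0 := by
        refine mul_le_mul_of_nonneg_left ?_ (mul_nonneg hr0 hR0)
        exact Finset.sum_le_sum fun p _ => Finset.sum_le_sum fun q _ => helem p q
    _ = r * (R * ((n : ℝ) * (n : ℝ)) * max Cf 0) := by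
        rw [Finset.sum_const, Finset.card_univ, Fintype.card_fin, nsmul_eq_mul, Finset.sum_const,
          Finset.card_univ, Fintype.card_fin, nsmul_eq_mul]
        ring

end Twisted

end Literature.NumberTheory.Automorphic
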